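import Summits.BirchSwinnertonDyer.BirchSwinnertonDyer.Theorems.GenusKolyvaginAtTwoGenusPrimitiveSupplyAtTwoAdmissibleExactDescent
import Summits.BirchSwinnertonDyer.BirchSwinnertonDyer.Theorems.GenusKolyvaginAtTwoEquivariantKolyvaginExactAtTwoEigenClassesFinite
import Literature.NumberTheory.EllipticCurves.LocalH1TateDualityLangTateProofs
import Literature.NumberTheory.EllipticCurves.QuadraticTwistRamifiedLocalPolynomialProofs
import Literature.NumberTheory.EllipticCurves.ComplexMultiplicationDeuringLocalPlaces
import Literature.NumberTheory.EllipticCurves.ArtinFormalismQuadraticLocalProofs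
import Literature.NumberTheory.EllipticCurves.SelmerGaloisAction
import Literature.NumberTheory.EllipticCurves.SelmerTorsionRelModelAction
import HarnessLib

/-!
# Route `GenusKolyvaginAtTwo`, cruxes 23491 `GenusDeepSupplyAtTwoNegDiscNarrow` / 25504: KRAMER'S INVARIANT PART AT A RAMIFIED, NON-SILENT
# PRIME — `Sel₂(E_K/K)^{Gal(K/ℚ)} = res_K Sel₂^{rel {ℓ₀, ∞}}(E)` for the PRIME Heegner field `K = ℚ(√−ℓ₀)`, with NO condition at `ℓ₀`

LEAD seat `bsd-line-gk2-p1` g22 (cell `bsd-f1-sign2`), `--supports stmt-BirchSwinnertonDyer-23491 --as helper`.  THEOREMS ONLY (no definition,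
no named fact, no `sorry`); UNCONDITIONAL.  **BSD is NOT proved by this file and no item is closed by it; the registered stub C‴ is untouched.**

WHY (positive-depth cell K₄ of C‴, `#Sel₂(E) = 4`).  The depth-zero files of the width seats (gk2-p5 g17 `…AdmissibleExactDescent` /
`…DescentSignIffSha`: `res_K⁻¹ Sel₂(E_K/K) = Sel₂^{rel ∞}(E)` for a DESCENT-ADMISSIBLE `d`, i.e. every ramified prime SILENT) do not cover the
Δ<0 supply frame, whose Heegner field `K = ℚ(√−ℓ₀)` is ramified at the DEF-1 prime `ℓ₀` (`#E(ℚ_{ℓ₀})[2] = 2`, NOT silent: `H¹(ℚ_{ℓ₀}, E[2]) ≠ 0`).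
This file supplies the missing local step and the resulting invariant-part theorem:

* §1 `ramificationIdx_eq_two_of_dvd_discr_of_under_eq` — at a prime `ℓ ∣ d_K` of a quadratic field the place `w ∣ ℓ` is unique and `e(w ∣ ℓ) = 2`
  (the tree's quadratic trichotomy + Dedekind's discriminant theorem; the pattern of gk2-p5 g33's `…DepthZeroInertia` §1).
* §2 **`mem_selmerLocalKer_adicCompletion_of_dvd_discr`** — THE LOCAL STEP: for `E/ℚ` with GOOD reduction at an ODD prime `ℓ ∣ d_K` and
  `w ∣ ℓ`, EVERY class `x ∈ H¹(ℚ, E[2])` satisfies the Selmer condition of `E_K` at `K_w`: its image `[x]_ℓ ∈ H¹(ℚ_ℓ, E)[2]` is split by the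
  RAMIFIED quadratic extension `K_w/ℚ_ℓ` — Lang–Tate 1958 (period `2` divides `e(K_w/ℚ_ℓ) = 2`; tree theorem
  `LangTate1958_split_of_dvd_ramificationIdx_of_local LangTate1958_cor1_local_holds`).  No silence, no condition on `#E(ℚ_ℓ)[2]`.
* §3 **`resTorsion_mem_selmerGroup_of_forall_ne`** — `K` imaginary quadratic with `d_K = −ℓ`, `E` good at the odd prime `ℓ`: a class
  `x ∈ H¹(ℚ, E[2])` satisfying `E`'s Kummer condition at every finite place `v ≠ (ℓ)` (NOTHING asked at `ℓ` or at `∞`) restricts into `Sel₂(E_K/K)`.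
* §4 **`mem_selmerLocalKer_of_resTorsion_mem_selmerGroup`** — conversely (`K` Heegner for `N_E`, `2` split, `d_K = −ℓ` odd):
  `res_K x ∈ Sel₂(E_K/K)` ⟹ `x` satisfies `E`'s condition at every finite `v ≠ (ℓ)` (split primes `p ∣ 2N`: gk2-p3's
  `selmerLocalKer_adicCompletion_eq_of_ncard_primesOver_eq_two`; good `p ∤ ℓ`: unramified, `…_of_not_dvd_discr`).
* §5 **`mem_selmerGroup_and_conjAct_eq_iff_exists_relaxed`** — KRAMER'S INVARIANT PART ON THE PRIME-HEEGNER-FIELD FRAME: with `E(K)[2] = 0`,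
  `m ∈ Sel₂(E_K/K)` is `Gal(K/ℚ)`-invariant iff `m = res_K x` for a (unique) `x ∈ Sel₂^{rel {ℓ,∞}}(E)`; and `natCard_fixed_eq` — the invariant
  subgroup has the cardinality of the `{ℓ,∞}`-relaxed Selmer group of `E`.

READING (LEAD-BRIEF-g22 §3, positive depth).  On the K₄ cell (Δ<0, `#Sel₂(E) = 4`, twin `#Sel₂(Wd) = 2` strict at `ℓ₀` by gk2-p5 g34
p764860) the `{ℓ₀,∞}`-relaxed group of `E` IS `Sel₂(E)` (Δ<0 kills `∞`; `[relaxed : strict] = #E(ℚ_{ℓ₀})[2] = 2` by Poitou–Tate), so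
`#Sel₂(E_K)^G = 4`; with `rank E(K) = 1` and the Cassels–Tate square over `K` this pins `dim Sel₂(E_K/K) = 3`, `Ш(E/K)[2] ≅ (ℤ/2)²` — the sequel file.
Kolyvagin–McCallum structure then reads: the deep witness of C‴, if it exists at all, exists at depth ONE (`M₁ = M_∞`).

References: [Kramer1981] Thm. 1 (proof), Prop. 3; [LangTate1958] Cor. 1 (via [ClarkSharif2010] §3.7 (i)); [MilneADT2006] I Prop. 3.8;
[SerreGaloisCohomology1997] I §2.6 (b); [GrossLMS1991] §5 (5.1); [NeukirchANT1999] I (8.5), III (2.12).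
-/

set_option linter.dupNamespace false -- tree convention: `Summit.BirchSwinnertonDyer.BirchSwinnertonDyer.Theorems` (summit = sub-problem)
set_option autoImplicit false

noncomputable section

open scoped Classical

namespace Summit.BirchSwinnertonDyer.BirchSwinnertonDyer.Theorems.GenusSupplyNarrow.RamifiedDescent

open WeierstrassCurve NumberField IsDedekindDomain Field
open Literature.NumberTheory.EllipticCurves Literature.NumberTheory.GaloisRepresentations
open Literature.Barriers.BirchSwinnertonDyer (Matsuno2009.primePlace)
open Rat.HeightOneSpectrum (primesEquiv)
open Summit.BirchSwinnertonDyer.BirchSwinnertonDyer.Theorems.GenusKolyArch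
  (mem_selmerLocalKer_adicCompletion_iff_resTorsion_mem forall_mem_selmerLocalKer_adicCompletion_of_resTorsion_mem_selmerGroup
    exists_eq_primePlace)

/-! ## §1 The ramified place of a quadratic field: unique above `ℓ ∣ d_K`, with `e = 2` -/

section Ramified

variable (K : Type) [Field K] [NumberField K]

/-- **At `ℓ ∣ d_K` the quadratic field `K` has a UNIQUE place `w ∣ ℓ`, and `e(w ∣ ℓ) = 2`** (Dedekind: `ℓ ∣ d_K` ⟹ some place above `ℓ` is
ramified, `exists_place_ramificationIdx_ne_one_of_dvd_discr`; the quadratic trichotomy `placesOver_trichotomy_of_finrank_eq_two` leaves only the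
ramified case).  Stated for an arbitrary place `w` above the place `v` of `ℚ`. [cite: NeukirchANT1999, Ch. I (8.5), Ch. III (2.12)] -/
theorem ramificationIdx_eq_two_of_dvd_discr_of_under_eq (h2 : Module.finrank ℚ K = 2) (v : HeightOneSpectrum (𝓞 ℚ))
    (hdvd : ((primesEquiv v : ℕ) : ℤ) ∣ NumberField.discr K) (w : HeightOneSpectrum (𝓞 K)) (hw : w.under (𝓞 ℚ) = v) :
    w.asIdeal.ramificationIdx (𝓞 ℚ) = 2 := by
  obtain ⟨w₀, hw₀v, hne⟩ := WeierstrassCurve.exists_place_ramificationIdx_ne_one_of_dvd_discr K v hdvd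
  have hw₀ : w₀.under (𝓞 ℚ) = v := HeightOneSpectrum.ext hw₀v
  rcases placesOver_trichotomy_of_finrank_eq_two K h2 v with
    ⟨w₁, w₂, -, -, hall⟩ | ⟨w', hS, he1, -⟩ | ⟨w', hS, he2, -⟩
  · exact absurd (hall w₀ hw₀).1 hne
  · have h0 : w₀ = w' := by simpa using (show w₀ ∈ ({w'} : Set _) by rw [← hS]; exact hw₀)
    subst h0
    exact absurd he1 hne
  · have h0 : w = w' := by simpa using (show w ∈ ({w'} : Set _) by rw [← hS]; exact hw)
    subst h0
    exact he2

end Ramified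

/-! ## §2 THE LOCAL STEP at a ramified good odd prime: every class of `H¹(ℚ, E[2])` satisfies the condition of `E_K` at `K_w` -/

section Local

variable (W : WeierstrassCurve ℚ) [W.IsElliptic] (K : Type) [Field K] [NumberField K]

/-- **Lang–Tate at a ramified prime of the quadratic field.**  `E/ℚ` elliptic with GOOD reduction at the place `v` of `ℚ` above an ODD prime,
`K` quadratic with `(p_v) ∣ d_K`, `w` the place of `K` above `v`: for EVERY `x ∈ H¹(ℚ, E[2])`, `x` satisfies the `2`-Selmer condition of
`E_K` at `K_w` — i.e. the image `[x] ∈ H¹(ℚ, E)[2]` restricted to `K` is locally trivial at `w`.  Proof: `2·[x] = 0`, `e(w ∣ v) = 2` (§1), and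
Lang–Tate (`LangTate1958_split_of_dvd_ramificationIdx_of_local` ∘ `LangTate1958_cor1_local_holds`: a `P`-torsion class of good reduction prime to `v` is split by any extension with
`P ∣ e`), read through the bridge `torsionH1ToH1_resTorsion` / `mem_localRestrictionKer_iff_resBaseChange_mem`.  No hypothesis on `#E(ℚ_v)[2]`
(the DEF-1 prime `ℓ₀` of the Δ<0 supply frame is NOT silent).  [cite: ClarkSharif2010, §3.7 (i) (reporting LangTate1958)]
[cite: Kramer1981, §2 Prop. 3] -/
theorem mem_selmerLocalKer_adicCompletion_of_dvd_discr (h2 : Module.finrank ℚ K = 2) (v : HeightOneSpectrum (𝓞 ℚ))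
    (hdvd : ((primesEquiv v : ℕ) : ℤ) ∣ NumberField.discr K) (h2v : ((2 : ℕ) : 𝓞 ℚ) ∉ v.asIdeal) (hgood : W.HasGoodReductionAt v)
    (w : HeightOneSpectrum (𝓞 K)) (hw : w.under (𝓞 ℚ) = v) (x : galH1Torsion W ((2 : ℕ) : ℤ)) :
    x ∈ selmerLocalKer W (w.adicCompletion K) ((2 : ℕ) : ℤ) := by
  rw [mem_selmerLocalKer_adicCompletion_iff_resTorsion_mem, WeierstrassCurve.mem_selmerLocalKer_iff_torsionH1ToH1_mem,
    torsionH1ToH1_resTorsion]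
  haveI : w.asIdeal.LiesOver v.asIdeal := ⟨by rw [← hw]; rfl⟩
  have he : w.asIdeal.ramificationIdx (𝓞 ℚ) = 2 := ramificationIdx_eq_two_of_dvd_discr_of_under_eq K h2 v hdvd w hw
  have h2η : (2 : ℕ) • torsionH1ToH1 W ((2 : ℕ) : ℤ) x = 0 := by
    rw [← map_nsmul, ← natCast_zsmul, zsmul_discreteH1_torsion ((2 : ℕ) : ℤ) x, map_zero]
  exact (LangTate1958_split_of_dvd_ramificationIdx_of_local LangTate1958_cor1_local_holds) W K (torsionH1ToH1 W ((2 : ℕ) : ℤ) x) 2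
    two_pos h2η v hgood h2v w (he ▸ dvd_rfl)

end Local

/-! ## §3 `Sel₂^{rel {ℓ,∞}}(E)` restricts INTO `Sel₂(E_K/K)` for the prime Heegner field -/

section Forward

variable (W : WeierstrassCurve ℚ) [W.IsElliptic] (K : Type) [Field K] [NumberField K]

/-- **`res_K Sel₂^{rel {ℓ,∞}}(E) ⊆ Sel₂(E_K/K)`.**  `K` imaginary quadratic with `(p_{v₀}) ∣ d_K` for a place `v₀` of `ℚ` above an odd prime
of GOOD reduction for `E`; `x ∈ H¹(ℚ, E[2])` satisfying `E`'s `2`-Selmer condition at every finite place `v ≠ v₀` — NO condition at `v₀`, none at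
`∞`.  Then `res_K x ∈ Sel₂(E_K/K)`: at a finite `w ∤ v₀` the class dies over `ℚ_v`, hence over `K_w` (`localRestrictionKer_le_of_tower`); at `w ∣ v₀`
by §2 (Lang–Tate); at the complex place the condition is empty.  (gk2-p5 g17's `resBaseChange_torsionH1ToH1_mem_sha_of_mem_relaxed` with the place
`v₀` removed from the hypothesis.) [cite: Kramer1981, §2 (proof of Thm. 1, the map S → Sel(E/K))] [cite: SerreGaloisCohomology1997, I §2.4] -/
theorem resTorsion_mem_selmerGroup_of_forall_ne (hK : IsImaginaryQuadratic K) (v₀ : HeightOneSpectrum (𝓞 ℚ))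
    (hdvd : ((primesEquiv v₀ : ℕ) : ℤ) ∣ NumberField.discr K) (h2v : ((2 : ℕ) : 𝓞 ℚ) ∉ v₀.asIdeal) (hgood : W.HasGoodReductionAt v₀)
    {x : galH1Torsion W ((2 : ℕ) : ℤ)}
    (hx : ∀ v : HeightOneSpectrum (𝓞 ℚ), v ≠ v₀ → x ∈ selmerLocalKer W (v.adicCompletion ℚ) ((2 : ℕ) : ℤ)) :
    resTorsion W K ((2 : ℕ) : ℤ) x ∈ selmerGroup (W.baseChange K) ((2 : ℕ) : ℤ) := by
  rw [selmerGroup_eq_comap_sha, AddSubgroup.mem_comap, torsionH1ToH1_resTorsion, WeierstrassCurve.mem_sha_iff]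
  refine ⟨fun w ↦ ?_, fun w ↦ ?_⟩
  · -- finite places: `w ∣ v := w ∩ ℤ`
    let v : HeightOneSpectrum (𝓞 ℚ) := w.under (𝓞 ℚ)
    by_cases hv : v = v₀
    · -- the ramified place: §2
      have h := mem_selmerLocalKer_adicCompletion_of_dvd_discr W K hK.1 v₀ hdvd h2v hgood w hv x
      rwa [mem_selmerLocalKer_adicCompletion_iff_resTorsion_mem, WeierstrassCurve.mem_selmerLocalKer_iff_torsionH1ToH1_mem,
        torsionH1ToH1_resTorsion] at h
    · haveI : w.asIdeal.LiesOver v.asIdeal := ⟨rfl⟩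
      letI : Algebra (v.adicCompletion ℚ) (w.adicCompletion K) := (adicCompletionMap (K := ℚ) K v w).toAlgebra
      haveI : IsScalarTower ℚ (v.adicCompletion ℚ) (w.adicCompletion K) :=
        IsScalarTower.of_algebraMap_eq fun y ↦ (adicCompletionMap_coe (K := ℚ) K v w y).symm
      have hfin : torsionH1ToH1 W ((2 : ℕ) : ℤ) x ∈ W.localRestrictionKer (v.adicCompletion ℚ) :=
        (WeierstrassCurve.mem_selmerLocalKer_iff_torsionH1ToH1_mem W (v.adicCompletion ℚ) x).mp (hx v hv)
      exact (mem_localRestrictionKer_iff_resBaseChange_mem W _).mp (localRestrictionKer_le_of_tower W (E := v.adicCompletion ℚ) hfin)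
  · -- complex places: no condition
    haveI : IsAlgClosed w.Completion :=
      isAlgClosed_of_ringEquiv (InfinitePlace.Completion.ringEquivComplexOfIsComplex (hK.2.isComplex w)).symm
    rw [localRestrictionKer_eq_top_of_isAlgClosed]
    trivial

end Forward

/-! ## §4 Conversely: `res_K x ∈ Sel₂(E_K/K)` gives `E`'s condition at every finite `v ≠ (ℓ)` (Heegner field, `2` split, `d_K = −ℓ`) -/

section Backward

variable (W : WeierstrassCurve ℚ) [W.IsElliptic] (K : Type) [Field K] [NumberField K]

/-- **EXACT DESCENT OFF THE RAMIFIED PRIME.**  `E/ℚ` elliptic (any model: `HasGoodReductionAt` and `conductorNorm` are the tree's), `K` quadratic with `d_K = −ℓ` odd (`ℓ` prime), every prime of `N_E` split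
in `K` (Heegner hypothesis) and `2` split in `K`.  If `res_K x ∈ Sel₂(E_K/K)` then `x` satisfies `E`'s `2`-Selmer condition at EVERY finite place
`v ≠ (ℓ)` of `ℚ`: a prime `p ∣ 2N_E` splits (`K_w = ℚ_p`, `selmerLocalKer_adicCompletion_eq_of_ncard_primesOver_eq_two`), a prime `p ∤ 2N_E`, `p ≠ ℓ` is
good and unramified (`selmerLocalKer_adicCompletion_eq_of_not_dvd_discr`, Milne I 3.8).  Nothing is claimed at `(ℓ)`.
[cite: Kramer1981, Thm. 1 (proof), §2 Prop. 3] [cite: MilneADT2006, Ch. I Prop. 3.8] [cite: DokchitserDokchitserAnnals2010, Lemma 4.14 (proof)] -/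
theorem mem_selmerLocalKer_of_resTorsion_mem_selmerGroup (h2 : Module.finrank ℚ K = 2)
    (hH : SatisfiesHeegnerHypothesis (W.conductorNorm ℤ) K) (h2K : ((Ideal.span {(2 : ℤ)}).primesOver (𝓞 K)).ncard = 2)
    (hodd : Odd (NumberField.discr K)) {ℓ : ℕ} (hℓ : ℓ.Prime) (hd : NumberField.discr K = -(ℓ : ℤ))
    {x : galH1Torsion W ((2 : ℕ) : ℤ)} (hx : resTorsion W K ((2 : ℕ) : ℤ) x ∈ selmerGroup (W.baseChange K) ((2 : ℕ) : ℤ))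
    (v : HeightOneSpectrum (𝓞 ℚ)) (hv : v ≠ Matsuno2009.primePlace ℓ) :
    x ∈ selmerLocalKer W (v.adicCompletion ℚ) ((2 : ℕ) : ℤ) := by
  obtain ⟨p, hp, rfl⟩ := exists_eq_primePlace v
  haveI := Fact.mk hp
  obtain ⟨w, hw⟩ := Literature.Barriers.BirchSwinnertonDyer.exists_heightOneSpectrum_liesOver K p
  haveI := hw
  have hxw : x ∈ selmerLocalKer W (w.adicCompletion K) ((2 : ℕ) : ℤ) :=
    forall_mem_selmerLocalKer_adicCompletion_of_resTorsion_mem_selmerGroup W K _ hx w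
  by_cases hsplit : p ∣ W.conductorNorm ℤ ∨ p = 2
  · -- split in `K`
    have hs : ((Ideal.span {(p : ℤ)}).primesOver (𝓞 K)).ncard = 2 := by
      rcases hsplit with hpN | rfl
      · exact hH p hp hpN
      · exact_mod_cast h2K
    rw [← GenusExact.PlusDescent.selmerLocalKer_adicCompletion_eq_of_ncard_primesOver_eq_two W K w h2 hp hs]
    exact hxw
  · rw [not_or] at hsplit
    obtain ⟨hpN, hp2⟩ := hsplit
    have hgood : W.HasGoodReductionAt (Matsuno2009.primePlace p) := by
      by_contra h
      apply hpN
      have := (W.dvd_conductorNorm_iff (Matsuno2009.primePlace p)).mpr h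
      rwa [Literature.Barriers.BirchSwinnertonDyer.Matsuno2009.primesEquiv_primePlace hp] at this
    have hpℓ : p ≠ ℓ := by
      rintro rfl
      exact hv rfl
    have hpd : ¬ (p : ℤ) ∣ NumberField.discr K := by
      rw [hd, dvd_neg]
      intro h
      exact hpℓ ((Nat.prime_dvd_prime_iff_eq hp hℓ).mp (by exact_mod_cast h))
    rw [← GenusExact.PlusDescent.selmerLocalKer_adicCompletion_eq_of_not_dvd_discr W K w h2 hodd hp hpd hgood]
    exact hxw

end Backward

/-! ## §5 KRAMER'S INVARIANT PART on the prime-Heegner-field frame: `Sel₂(E_K/K)^{Gal(K/ℚ)} = res_K Sel₂^{rel {ℓ,∞}}(E)` -/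

section Invariant

variable (W : WeierstrassCurve ℚ) [W.IsElliptic] (K : Type) [Field K] [NumberField K]

/-- **`Sel₂(E_K/K)^{Gal(K/ℚ)} = res_K Sel₂^{rel {ℓ,∞}}(E)` for the prime Heegner field `K = ℚ(√−ℓ)`.**  `E/ℚ` with GOOD reduction
at the odd prime `ℓ`, `K` imaginary quadratic with `d_K = −ℓ`, Heegner for `N_E`, `2` split, and `E(K)[2] = 0` (`hL`; on the habitat from
`ρ̄_{E,2}` onto).  For ANY non-trivial `σ₀ ∈ Aut(K/ℚ)`: a class `m ∈ H¹(K, E_K[2])` is a `σ₀`-invariant `2`-Selmer class of `E_K` iff `m = res_K x`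
for some `x ∈ H¹(ℚ, E[2])` satisfying `E`'s condition at every finite `v ≠ (ℓ)` (then `x` is unique: `resTorsion_injective_of_noTorsion`).
Inflation–restriction (`GenusExact.EigenClassesFinite.mem_range_resTorsion_iff_conjAct_eq`) + §3 + §4.  This is Kramer 1981 Thm. 1, invariant
part, at a frame whose ramified prime is NOT silent — the Δ<0 supply frame of cruxes 23491/25504.
[cite: Kramer1981, Thm. 1 (proof)] [cite: GrossLMS1991, §5 (5.1)] [cite: SerreGaloisCohomology1997, I §2.6 (b)] -/
theorem mem_selmerGroup_and_conjAct_eq_iff_exists_relaxed (hK : IsImaginaryQuadratic K)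
    (hH : SatisfiesHeegnerHypothesis (W.conductorNorm ℤ) K) (h2K : ((Ideal.span {(2 : ℤ)}).primesOver (𝓞 K)).ncard = 2)
    (hodd : Odd (NumberField.discr K)) {ℓ : ℕ} (hℓ : ℓ.Prime) (hd : NumberField.discr K = -(ℓ : ℤ))
    (h2ℓ : ((2 : ℕ) : 𝓞 ℚ) ∉ (Matsuno2009.primePlace ℓ).asIdeal) (hgood : W.HasGoodReductionAt (Matsuno2009.primePlace ℓ))
    (hL : ∀ P : (W.baseChange K).toAffine.Point, ((2 : ℕ) : ℤ) • P = 0 → P = 0)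
    {σ₀ : K ≃ₐ[ℚ] K} (hσ₀ : σ₀ ≠ 1) (m : galH1Torsion (W.baseChange K) ((2 : ℕ) : ℤ)) :
    (m ∈ selmerGroup (W.baseChange K) ((2 : ℕ) : ℤ) ∧ conjAct W σ₀ ((2 : ℕ) : ℤ) m = m) ↔
      ∃ x : galH1Torsion W ((2 : ℕ) : ℤ),
        (∀ v : HeightOneSpectrum (𝓞 ℚ), v ≠ Matsuno2009.primePlace ℓ → x ∈ selmerLocalKer W (v.adicCompletion ℚ) ((2 : ℕ) : ℤ)) ∧
        resTorsion W K ((2 : ℕ) : ℤ) x = m := by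
  have h2 : Module.finrank ℚ K = 2 := hK.1
  haveI : IsGalois ℚ K := isGalois_of_finrank_eq_two K h2
  obtain ⟨θ, hθ, hc⟩ := Literature.NumberTheory.EllipticCurves.exists_sq_eq_discr_not_mem_range K h2
  have hdvd : ((primesEquiv (Matsuno2009.primePlace ℓ) : ℕ) : ℤ) ∣ NumberField.discr K := by
    rw [Literature.Barriers.BirchSwinnertonDyer.Matsuno2009.primesEquiv_primePlace hℓ, hd]
    exact dvd_neg.mpr dvd_rfl
  constructor
  · rintro ⟨hm, hσm⟩
    have hall : ∀ σ : K ≃ₐ[ℚ] K, conjAct W σ ((2 : ℕ) : ℤ) m = m :=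
      (RelModel.forall_conjAct_eq_iff_of_finrank_eq_two K W ((2 : ℕ) : ℤ) σ₀ h2 hσ₀ m).mpr hσm
    obtain ⟨x, hx⟩ := (GenusExact.EigenClassesFinite.mem_range_resTorsion_iff_conjAct_eq W K h2 hθ hc _ hL m).mpr (hall _)
    refine ⟨x, fun v hv ↦ ?_, hx⟩
    exact mem_selmerLocalKer_of_resTorsion_mem_selmerGroup W K h2 hH h2K hodd hℓ hd (by rw [hx]; exact hm) v hv
  · rintro ⟨x, hx, rfl⟩
    exact ⟨resTorsion_mem_selmerGroup_of_forall_ne W K hK (Matsuno2009.primePlace ℓ) hdvd h2ℓ hgood hx,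
      conjAct_resTorsion K W _ σ₀ h2 hσ₀ x⟩

end Invariant

end Summit.BirchSwinnertonDyer.BirchSwinnertonDyer.Theorems.GenusSupplyNarrow.RamifiedDescent

end
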